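import Summits.BirchSwinnertonDyer.Rank1Residual.GaloisImage.KolyvaginSystemOfEulerSystemPairBad
import Summits.BirchSwinnertonDyer.Rank1Residual.GaloisImage.KolyvaginSystemOfEulerSystemTorsionCoeff
import Summits.BirchSwinnertonDyer.Rank1Residual.GaloisImage.KatoKuriharaValueGeneralLevelParity
import Summits.BirchSwinnertonDyer.Rank1Residual.GaloisImage.KolyvaginPrimeOfFrobeniusClassDeep
import Summits.BirchSwinnertonDyer.Rank1Residual.GaloisImage.KatoKuriharaPortThreeWith
import Summits.BirchSwinnertonDyer.Rank1Residual.GaloisImage.PropagatedConditionTopOfNoTorsionThree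
import Summits.BirchSwinnertonDyer.Rank1Residual.GaloisImage.TorsionReductionOfLe
import Literature.NumberTheory.EllipticCurves.NonEisensteinPrimeOfSurjective
import HarnessLib

/-!
# END-b F2 — ★ PK-6₂'s END-b twin: PORT″'s two-level dictionary `KatoKuriharaDictionaryThreeAt₂At`
# at `t = 0` FROM KATO'S EULER SYSTEM on the rows WITH ANOMALOUS bad places, for the data THINNED to
# the cube-order primes (cell `b2b-bsdres`, team n1011, seat p13 GEN 15 — PK-6 lineage; lead
# R5-115 (a), R5-119 (b) + ADD 1; planner r1 GEN 48 (C) option (a), GEN 49 (d1)–(d4); ROUTE-1 §60–§61)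

HONEST FRAMING (cell `b2b-bsdres`, run/shared/lean/b2b/bsd-rank1-residual/, verbatim in every
file): the goal of the cell is to DELETE the COMBINATION-SHAPED residual classes of the
Birch–Swinnerton-Dyer formula for ALL analytic-rank `≤ 1` elliptic curves over `ℚ` — "full BSD
formula for every rank `≤ 1` curve in class `C`" assembled STRICTLY from published theorems — so
that the rank-`≤ 1` remainder becomes exactly the CONSTRUCTION-SHAPED classes, which are TYPED
(missing-input `Prop`s), NOT attempted. This is not "finishing BSD". Team n1011 (N10/N11; ROUTE 1,
the PORT anatomy (P-KIM) of class X4 ∧ `p = 3`): research route on CONSTRUCTION-SHAPED classes;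
prove what is provable now; no claim beyond stated classes; census output = EVIDENCE, never a
Literature fact; RESIDUAL-MAP marks UNCHANGED; nothing is booked by this file.  THIS IS AN END
THEOREM WITH DISPLAYED HYPOTHESES — it closes NO row by itself and NO END-b record is filed with it:
on a `t = 0` row the body of the typed missing-input predicate PORT″ (`KatoKuriharaPortThreeAtWith₂`,
n1011-p18, flag `K22-Thm3.13-PORT@3`) is REACHED for every pair of `τ`-data With-guarded for the same
generator family `η` WHOSE PRIMES LIE IN THE CUBE-ORDER SET `𝒫″` of the row (`3 ∤ ord(w mod q)` for
every anomalous bad place `w` — planner r1's 'D.primes ⊆ class ∩ C_B', `B` = the anomalous bad places,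
not a binder), from (a) Kato's cited fact's matrix `ZetaBody` on DISPLAYED witnesses bound for `P.f`
(ROUTE-1 §48.4 socket), (b) the CONSTRUCTION-SHAPED (P-EXP) riders `KatoExpStarFiniteLevelAt W 3 j 0 v₃
Λ (Λfin j)` at every depth (never `_holds`), (c) THEOREM D's certificate `ht0` (no `3`-torsion over
`ℚ₃`: `t = 0`) — and NO `hbad`, (d) `hcdA` with `hN : N = N_E`, (e) the per-level VALUE ROWS
`hvalue` (n1011-p02's T-PK6-VROW OUT, displayed).  0 defs / 0 facts / 0 sorry.

## What and how

`katoKuriharaDictionaryThreeAt₂At_zero_of_zetaBody_of_primes'' : … →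
KatoKuriharaDictionaryThreeAt₂At W 0 k k′ D D′ red v₃ P` — EXACTLY the binder list of n1011-p13's
★ PK-6₂ `katoKuriharaPortThreeAtWith₂_zero_of_zetaBody` (p328933) with THEOREM D's `hbad` DELETED,
followed by PORT″'s own binders (`k k′ D D′ red`, the two With-guards
`IsCanonicalTauDatumThreeAtWith W k k η` / `… k′ k′ η` — the `τ`-binder of E1-deep's `hτq` shape
`ZMod (3^(k+1))` lives inside them, as in PORT″) and the two thinning clauses `hP″`, `hP″₂` in the
token shape of n1011-p15's T-DER-D4BN F2.  PK-6₂ is the case without anomalous bad places (both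
clauses vacuous); here those rows are NOT excluded.  Proof = PK-6₂'s: DICT3₂At's antecedents are
introduced (`Addv`, `¬3 ∣ c₃`, Manin, period not read — rider (α); surj(3) ⇒ `Irr(E[3])`); the
guards give THEOREM D's `hT`/`hC`; E1-deep `KolyvaginPrime.isKolyvaginPrime_succ_of_mem_frobeniusClassPrimes`
gives `hKol` at levels `k+1`, `k′+1`; `hcdA` + `hN` give `hPr` (usable primes of Kato's system);
`ht0` gives `𝓕_can,3 = ⊤` at every depth (Mazur–Rubin Lemma A.1 along `exists_torsionReduction_three`);
then — in place of T-PK62-PAIR — THEOREM D at the two depths ON `𝒫″`-DATA with ONE `σ` and (COMP)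
(this seat's D7-b `Derivative.Rat.exists_isKolyvaginSystem_pair_propagatedSelmerStructure_of_primes''`,
fed `hbody.1`, the torsion coefficient systems of GZ-2 with pins `rfl`, `hP″`/`hP″₂`), the witness
clauses per depth by n1011-p13's T-PK6-GEN
`KatoValue.GeneralLevel.exists_unit_apply_localization_eq_of_derivativeFamily` on the value rows, and
the diagonal packaging `κ′ = κ`, `κu′ = κu`.

HONEST LIMITS: `t = 0` only; the value rows are hypotheses; NO thinned datum is CONSTRUCTED here and
NO prime of `𝒫″` is chosen (the records' side: n1011-p11's T-KS-RES `restrictPrimes` +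
`hasCanonicalComparison_restrictPrimes` for the datum, T-PC-THIN + Binders for the thinned prime
choice, the cube-residue bridge and the Kummer–Δ certificate `hΔB` of planner r1's (R-v⁺) for the
`τ`-existence — none consumed by this producer); rows with `supp cubefree(Δ_min) ⊆ B` (END-b-DEAD) have
no useful datum; nothing is booked; no PORT″-b predicate is defined here (typer's call).

References: K. Kato, Astérisque 295 (2004) §9.4, Thm. 9.7, Ex. 13.3 [Kato2004Asterisque]; C.-H. Kim,
AJM 148 = arXiv:2203.12159, Thm. 3.13, §1.2.2, §2.2.2, §3.3–§3.4.1 [Kim2022StructureSelmer]; B. Mazur,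
K. Rubin, Mem. AMS 799 (2004), Def. 3.1.3, 3.2.1, Thm. 3.2.4, App. A [MazurRubin2004]; K. Rubin,
*Euler Systems* (2000) Def. 4.4.4, Thm. 4.5.1 [Rubin2000]; R. Sakamoto, JTNB 36 (2024) §2, Def. 4.1
[Sakamoto2024]; design `cells/n1011/ROUTE-1.md` §43.5 (a), §58, §60.5 (C), §61.3; lead R5-115 (a),
R5-119 ADD 1; `cells/n1011/skel/T-ENDB-F2.md`.
-/

noncomputable section

open scoped NumberField TensorProduct ContRepresentation Classical
open CategoryTheory Field Function Finset IsDedekindDomain NumberField WeierstrassCurve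
open Rat.HeightOneSpectrum
open Literature.NumberTheory.GaloisRepresentations Literature.NumberTheory.GaloisCohomology
open Literature.NumberTheory.GaloisRepresentations.DiscreteGaloisModule
open Literature.NumberTheory.EllipticCurves Literature.NumberTheory.EllipticCurves.ModularForms
open Literature.NumberTheory.EllipticCurves.Kato2004
open Literature.NumberTheory.EllipticCurves.Kato2004.EulerSystemValues
open Summit.BirchSwinnertonDyer.Rank1Residual.GaloisImage.TorsionCoeff

namespace Summit.BirchSwinnertonDyer.Rank1Residual.GaloisImage

variable (W : WeierstrassCurve ℚ) [W.IsElliptic] [W.IsGloballyMinimal]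
  [ContinuousSMul ℤ_[3] (W.tateModule 3)] [Module.Free ℤ_[3] (W.tateModule 3)]
  [Module.Finite ℤ_[3] (W.tateModule 3)]

/-- Local notation: `𝐃F⟦r, τ⟧ ℓ = Σ_{j<ℓ−1} j·σ_{χ_{m(0,r)}(τ_ℓ)}^j` on the level field `ℚ(ζ_{m(0,r)})`
(PK-1 ★2's field-side spelling, `p = 3`). -/
local notation3 (prettyPrint := false) "𝐃F⟦" r ", " τ "⟧" =>
  fun ℓ : HeightOneSpectrum (𝓞 ℚ) =>
  ∑ j ∈ Finset.range (((primesEquiv ℓ : Nat.Primes) : ℕ) - 1),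
    (j : Module.End ℚ (CyclotomicField (cycLevel 3 0 r) ℚ)) *
      (sigma (cycLevel 3 0 r) (modNCyclotomicCharacter ℚ (cycLevel 3 0 r)
          ((τ : HeightOneSpectrum (𝓞 ℚ) → absoluteGaloisGroup ℚ) ℓ)) :
        CyclotomicField (cycLevel 3 0 r) ℚ →ₐ[ℚ] CyclotomicField (cycLevel 3 0 r) ℚ).toLinearMap ^ j

set_option backward.isDefEq.respectTransparency false in
/-- **END-b F2: PORT″'s two-level dictionary at `t = 0` from Kato's Euler system ON THE THINNED
DATA of a row with anomalous bad places** (module docstring).  Displayed: ★ PK-6₂'s `P`/`hN`,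
`hbody` for `P.f`, the rider family `hfin`, `hcdA`, THEOREM D's `ht0` (and NO `hbad`), the value rows
`hvalue`; then the two depths `k ≤ k′` (an antecedent of the conclusion), the data `D`, `D′` with
their With-guards for the SAME `η`, the pinned `red`, and the thinning clauses `hP″`, `hP″₂`
(`3 ∤ ord(w mod q)` for every prime `q` of the datum and every anomalous bad `w ≠ 3`); concluded:
`KatoKuriharaDictionaryThreeAt₂At W 0 k k′ D D′ red v₃ P`.
[cite: Kato2004Asterisque, §9.4 (p. 188), Thm. 9.7 (p. 189) and Ex. 13.3 (pp. 224–225)]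
[cite: Kim2022StructureSelmer, Thm. 3.13 and §1.2.2, §2.2.2, §3.3–§3.4.1 (arXiv v3 pp. 12, 17–18, 26–27)]
[cite: MazurRubin2004, Def. 3.1.3, Def. 3.2.1, Thm. 3.2.4 and App. A (Lemma A.1)]
[cite: Rubin2000, Def. 4.4.4 and Thm. 4.5.1] [cite: Sakamoto2024, §2 and Def. 4.1] -/
theorem katoKuriharaDictionaryThreeAt₂At_zero_of_zetaBody_of_primes''
    {N : ℕ} [NeZero N] (P : ModularParametrizationData W N) (hN : N = W.conductorNorm ℤ)
    {ι : (n : ℕ) → (CyclotomicField n ℚ →+* ℂ)} {κK : ℝ}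
    {Λ : ∀ (k' : ℕ) (r : Finset (HeightOneSpectrum (𝓞 ℚ))),
      H1 (tateRep W 3) (cycSubgroup 3 k' r) →ₗ[ℤ_[3]] ℚ_[3] ⊗[ℚ] CyclotomicField (cycLevel 3 k' r) ℚ}
    {c d a : ℤ} {A : ℕ}
    {z : ∀ (k' : ℕ) (r : (cyclotomicLevelsRat 3 (badPlaces c d A N)).Ideals),
      H1 (tateRep W 3) ((cyclotomicLevelsRat 3 (badPlaces c d A N)).level k' r.1)}
    {x : ∀ (k' : ℕ) (r : (cyclotomicLevelsRat 3 (badPlaces c d A N)).Ideals),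
      CyclotomicField (cycLevel 3 k' r.1) ℚ}
    (hbody : ZetaBody W 3 P.f ι κK Λ c d a A z x)
    {v₃ : HeightOneSpectrum (𝓞 ℚ)}
    (Λfin : ∀ j : ℕ, galoisCohomology ((W.torsionGaloisModule (((3 : ℕ) : ℤ) ^ j * ((3 : ℕ) : ℤ))).toLocal
      (Sum.inr v₃)) 1 →+ ZMod (3 ^ (j + 1)))
    (hfin : ∀ j : ℕ, KatoExpStarFiniteLevelAt W 3 j 0 v₃ Λ (Λfin j))
    {η : (q : HeightOneSpectrum (𝓞 ℚ)) → (ZMod (Ideal.absNorm q.asIdeal))ˣ}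
    -- the auxiliary datum avoids every prime `≡ 1 (mod 3)` (so every Kolyvagin prime is usable)
    (hcdA : ∀ q : ℕ, q.Prime → q ≡ 1 [MOD 3] → ¬ q ∣ 2 * c.natAbs * d.natAbs * A)
    -- THEOREM D's row certificate at the place `3` (`t = 0`); NO `hbad`
    (ht0 : ∀ w : HeightOneSpectrum (𝓞 ℚ), ((3 : ℕ) : 𝓞 ℚ) ∈ w.asIdeal →
        ∀ Q : (W.baseChange (w.adicCompletion ℚ)).toAffine.Point, 3 • Q = 0 → Q = 0)
    -- the per-level VALUE ROWS (T-PK6-VROW's OUT), displayed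
    (hvalue : ∀ (j : ℕ) (σ : HeightOneSpectrum (𝓞 ℚ) → absoluteGaloisGroup ℚ),
      (∀ q, σ q ∈ (adicCompletionPrime ℚ q).inertia (absoluteGaloisGroup ℚ)) →
      (∀ q, modNCyclotomicCharacter ℚ (Ideal.absNorm q.asIdeal) (σ q) = η q) →
      ∀ (r : Finset (HeightOneSpectrum (𝓞 ℚ)))
        (hr : ∀ q ∈ r, q ∈ (cyclotomicLevelsRat 3 (badPlaces c d A N)).primes),
        (∀ q ∈ r, Kato.IsKolyvaginPrime W 3 (j + 1) ((primesEquiv q : Nat.Primes) : ℕ)) →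
        (∀ q ∈ r, Subgroup.zpowers (η q) = ⊤) →
        ∃ (s : ℤ_[3]) (u : (ZMod (3 ^ (j + 1)))ˣ)
          (ψ : (ℓ : ℕ) → (ZMod ℓ)ˣ →* Multiplicative (ZMod (3 ^ (j + 1)))),
          (∀ q ∈ r, Function.Surjective (ψ (Ideal.absNorm q.asIdeal))) ∧
          (∃ l ∈ cycIntLattice 3 (cycLevel 3 0 r),
            (((3 : ℕ) : ℤ_[3]) ^ (0 : ℕ)) • ((1 : ℚ_[3]) ⊗ₜ[ℚ]
              ((r.noncommProd 𝐃F⟦r, σ⟧ (ZetaValue.pairwise_commute_fieldDeriv (cycLevel 3 0 r)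
                  (fun ℓ => modNCyclotomicCharacter ℚ (cycLevel 3 0 r) (σ ℓ))
                  (fun ℓ => ((primesEquiv ℓ : Nat.Primes) : ℕ) - 1) r))
                (x 0 ⟨r, hr⟩ + sigma (cycLevel 3 0 r) (-1) (x 0 ⟨r, hr⟩)))) -
              ((s : ℚ_[3]) ⊗ₜ[ℚ] (1 : CyclotomicField (cycLevel 3 0 r) ℚ)) =
            (((3 : ℕ) : ℤ_[3]) ^ (j + 1)) • (l : ℚ_[3] ⊗[ℚ] CyclotomicField (cycLevel 3 0 r) ℚ)) ∧
          haveI : NeZero (∏ q ∈ r, Ideal.absNorm q.asIdeal) :=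
            ⟨Finset.prod_ne_zero_iff.2 fun q _ h => q.ne_bot (Ideal.absNorm_eq_zero_iff.1 h)⟩
          PadicInt.toZModPow (j + 1) s = (u : ZMod (3 ^ (j + 1))) *
            ((3 : ℕ) : ZMod (3 ^ (j + 1))) ^ (0 : ℕ) *
              kuriharaNumber P.f (3 ^ (j + 1)) (∏ q ∈ r, Ideal.absNorm q.asIdeal) ψ)
    -- PORT″'s own binders: the two depths, the two data With-guarded for the SAME `η`, the reduction
    {k k' : ℕ} (D : KolyvaginDatum (W.torsionGaloisModule (((3 : ℕ) : ℤ) ^ k * ((3 : ℕ) : ℤ))))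
    (D' : KolyvaginDatum (W.torsionGaloisModule (((3 : ℕ) : ℤ) ^ k' * ((3 : ℕ) : ℤ))))
    (red : (W.torsionGaloisModule (((3 : ℕ) : ℤ) ^ k' * ((3 : ℕ) : ℤ))).toContRepresentation →ⁱL
      (W.torsionGaloisModule (((3 : ℕ) : ℤ) ^ k * ((3 : ℕ) : ℤ))).toContRepresentation)
    (hDW : D.IsCanonicalTauDatumThreeAtWith W k k η) (hDW' : D'.IsCanonicalTauDatumThreeAtWith W k' k' η)
    -- the thinning of the primes at the ANOMALOUS bad places (`𝒫″`): `𝒫(D), 𝒫(D′) ⊆ class ∩ C_B`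
    (hP'' : ∀ q ∈ D.primes, ∀ w : HeightOneSpectrum (𝓞 ℚ), ¬ W.HasGoodReductionAt w →
      ((primesEquiv w : Nat.Primes) : ℕ) ≠ 3 →
      (∃ Q : (W.baseChange (w.adicCompletion ℚ)).toAffine.Point, 3 • Q = 0 ∧ Q ≠ 0) →
        ¬ 3 ∣ orderOf ((((primesEquiv w : Nat.Primes) : ℕ) : ZMod ((primesEquiv q : Nat.Primes) : ℕ))))
    (hP''₂ : ∀ q ∈ D'.primes, ∀ w : HeightOneSpectrum (𝓞 ℚ), ¬ W.HasGoodReductionAt w →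
      ((primesEquiv w : Nat.Primes) : ℕ) ≠ 3 →
      (∃ Q : (W.baseChange (w.adicCompletion ℚ)).toAffine.Point, 3 • Q = 0 ∧ Q ≠ 0) →
        ¬ 3 ∣ orderOf ((((primesEquiv w : Nat.Primes) : ℕ) : ZMod ((primesEquiv q : Nat.Primes) : ℕ)))) :
    KatoKuriharaDictionaryThreeAt₂At W 0 k k' D D' red v₃ P := by
  intro hkk' hred _hadd _hc3 hsurj _ht hv₃ _hcP _hper
  letI := TorsionCoeff.torsionBy.padicIntModule 3 (k + 1) (WeierstrassCurve.geomPoints W)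
  letI := TorsionCoeff.torsionBy.padicIntModule 3 (k' + 1) (WeierstrassCurve.geomPoints W)
  -- the guards
  obtain ⟨hT, hC, S, τ, hS, hτμ, hτq, hP⟩ := hDW
  obtain ⟨hT', hC', S', τ', hS', hτμ', hτq', hP'⟩ := hDW'
  have hirr : W.HasIrreducibleModPGaloisRep 3 :=
    hasIrreducibleModPGaloisRep_of_hasSurjectiveModNGaloisRep W 3 hsurj
  have hv₃p : ((primesEquiv v₃ : Nat.Primes) : ℕ) = 3 := primesEquiv_eq_of_natCast_mem Nat.prime_three hv₃
  -- Kolyvagin primes of the right levels (E1-deep on the classes of the guards)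
  have hKol : ∀ q ∈ D.primes, Kato.IsKolyvaginPrime W 3 (k + 1) ((primesEquiv q : Nat.Primes) : ℕ) :=
    fun q hq => KolyvaginPrime.isKolyvaginPrime_succ_of_mem_frobeniusClassPrimes W k
      (fun v hv => (hS v hv).1) hτμ hτq (hP hq)
  have hKol' : ∀ q ∈ D'.primes, Kato.IsKolyvaginPrime W 3 (k' + 1) ((primesEquiv q : Nat.Primes) : ℕ) :=
    fun q hq => KolyvaginPrime.isKolyvaginPrime_succ_of_mem_frobeniusClassPrimes W k'
      (fun v hv => (hS' v hv).1) hτμ' hτq' (hP' hq)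
  -- every Kolyvagin prime is a usable prime of Kato's system for `(c, d, A, N)`
  have husable : ∀ (j : ℕ) (q : HeightOneSpectrum (𝓞 ℚ)),
      Kato.IsKolyvaginPrime W 3 (j + 1) ((primesEquiv q : Nat.Primes) : ℕ) →
        q ∈ (cyclotomicLevelsRat 3 (badPlaces c d A N)).primes := by
    intro j q hq
    have hℓ := hq.prime
    have h13 : ((primesEquiv q : Nat.Primes) : ℕ) ≡ 1 [MOD 3] :=
      hq.modEq_one.of_dvd (dvd_pow_self 3 (Nat.succ_ne_zero j))
    refine (mem_primes_cyclotomicLevelsRat_badPlaces_iff 3 c d A N q).2 ⟨fun hdvd => ?_, hq.ne⟩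
    rcases (Nat.Prime.dvd_mul hℓ).mp hdvd with h | h
    · exact hcdA _ hℓ h13 h
    · apply hq.not_dvd
      rw [← hN]
      exact dvd_mul_of_dvd_left h 3
  have hPr : D.primes ⊆ (cyclotomicLevelsRat 3 (badPlaces c d A N)).primes :=
    fun q hq => husable k q (hKol q hq)
  have hPr' : D'.primes ⊆ (cyclotomicLevelsRat 3 (badPlaces c d A N)).primes :=
    fun q hq => husable k' q (hKol' q hq)
  -- `𝓕_can,3 = ⊤` at every depth (`t = 0`, Mazur–Rubin Lemma A.1 along the reduction tower)
  have htower : ∀ j : ℕ,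
      ∃ redj : (W.torsionGaloisModule (((3 : ℕ) : ℤ) ^ (j + 1) * ((3 : ℕ) : ℤ))).toContRepresentation →ⁱL
          (W.torsionGaloisModule (((3 : ℕ) : ℤ) ^ j * ((3 : ℕ) : ℤ))).toContRepresentation,
        ∀ y : geomTorsion W (((3 : ℕ) : ℤ) ^ (j + 1) * ((3 : ℕ) : ℤ)),
          ((redj y : geomTorsion W (((3 : ℕ) : ℤ) ^ j * ((3 : ℕ) : ℤ))) : geomPoints W) =
            ((3 : ℕ) : ℤ) • (y : geomPoints W) := by
    intro j
    obtain ⟨redj, hredj⟩ := exists_torsionReduction_three W j (j + 1)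
    refine ⟨redj, fun y => ?_⟩
    rw [hredj, Nat.add_sub_cancel_left, pow_one]
  choose redT hredT using htower
  have htop : ∀ (j : ℕ) (w : HeightOneSpectrum (𝓞 ℚ)), ((primesEquiv w : Nat.Primes) : ℕ) = 3 →
      propagatedSelmerStructure W 3 j (Sum.inr w) = ⊤ := by
    intro j w hw
    have hw3 : ((3 : ℕ) : 𝓞 ℚ) ∈ w.asIdeal := KolyvaginPrime.natCast_mem_asIdeal_of_primesEquiv_eq hw
    exact propagatedSelmerStructure_three_eq_top_of_torsion_eq_zero W w hw3 (ht0 w hw3) redT hredT j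
  -- the two coefficient systems `E[3^{j+1}]_{ℤ₃}` (GZ-2), reductions onto, pins `rfl`
  have hredk : Function.Surjective
      (tateModuleRed W 3 (W.continuous_galoisRepTate_holds 3) (k + 1)).hom := by
    intro y
    obtain ⟨b, hb⟩ := W.proj_surjective_of_isAlgClosed_holds 3 (k + 1) y.2
    exact ⟨b, Subtype.ext hb⟩
  have hredk' : Function.Surjective
      (tateModuleRed W 3 (W.continuous_galoisRepTate_holds 3) (k' + 1)).hom := by
    intro y
    obtain ⟨b, hb⟩ := W.proj_surjective_of_isAlgClosed_holds 3 (k' + 1) y.2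
    exact ⟨b, Subtype.ext hb⟩
  -- THEOREM D at the two depths ON THE THINNED DATA for Kato's system `z` (D7-b): ONE `σ`, (COMP)
  obtain ⟨σ, Φ, comm, κf, Φ'', comm'', κu, hσI, hσχ, hΦ, hΦ'', hKS, hKS', -, -, hres, hres', hcomp⟩ :=
    Derivative.Rat.exists_isKolyvaginSystem_pair_propagatedSelmerStructure_of_primes'' W 3
      (badPlaces c d A N) (by decide) hkk' hbody.1
      (tateModuleRed W 3 (W.continuous_galoisRepTate_holds 3) (k + 1)) hredk
      (fun y => pow_smul_eq_zero 3 (k + 1) _ y)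
      (AddSubgroup.inclusion (geomTorsion_pow_succ_eq W 3 k).le : _ →+ _) continuous_of_discreteTopology
      (fun _ _ => rfl)
      (AddSubgroup.inclusion (geomTorsion_pow_succ_eq W 3 k).ge : _ →+ _) continuous_of_discreteTopology
      (fun y => Subtype.ext rfl) (fun y => Subtype.ext rfl) (fun _ => rfl)
      (tateModuleRed W 3 (W.continuous_galoisRepTate_holds 3) (k' + 1)) hredk'
      (fun y => pow_smul_eq_zero 3 (k' + 1) _ y)
      (AddSubgroup.inclusion (geomTorsion_pow_succ_eq W 3 k').le : _ →+ _) continuous_of_discreteTopology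
      (fun _ _ => rfl)
      (AddSubgroup.inclusion (geomTorsion_pow_succ_eq W 3 k').ge : _ →+ _) continuous_of_discreteTopology
      (fun y => Subtype.ext rfl) (fun y => Subtype.ext rfl) (fun _ => rfl)
      red hred hirr D hT D' hT' hC hC' hPr hPr' hKol hKol' hP'' hP''₂ (htop k) (htop k')
  refine ⟨κf, Λfin k, κf, κu, Λfin k', κu, ?_, ?_, fun e he' he => ⟨hcomp e he he', hcomp e he he'⟩⟩
  · -- depth `k`: (0), (I4) with `κ′ = κ`, (Λ) from the rider, (DICT3) per level from T-PK6-GEN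
    refine ⟨fun e he => hKS.mem_selmerGroup e he,
      ⟨hKS, fun e _ => by rw [sub_self]; exact zero_mem _⟩, (hfin k).1, (hfin k).2.1, fun r hr => ?_⟩
    obtain ⟨s, u, ψ, hψ, hval, hw⟩ := hvalue k σ hσI hσχ r
      (fun q hq => hPr (hr (Finset.mem_coe.2 hq))) (fun q hq => hKol q (hr (Finset.mem_coe.2 hq)))
      (fun q hq => hC.zpowers_eq_top (hr (Finset.mem_coe.2 hq)))
    obtain ⟨u', hu'⟩ := KatoValue.GeneralLevel.exists_unit_apply_localization_eq_of_derivativeFamily W 3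
      P.f ι κK Λ c d a A z x (by decide) hbody (hfin k)
      (tateModuleRed W 3 (W.continuous_galoisRepTate_holds 3) (k + 1))
      (AddSubgroup.inclusion (geomTorsion_pow_succ_eq W 3 k).le : _ →+ _) continuous_of_discreteTopology
      (fun _ _ => rfl) (fun _ => rfl) D hPr σ Φ comm κf hΦ hKS hres hv₃p r hr s hval u hw
    exact ⟨u', ψ, hψ, hu'⟩
  · -- depth `k′`: the same
    refine ⟨fun e he => hKS'.mem_selmerGroup e he,
      ⟨hKS', fun e _ => by rw [sub_self]; exact zero_mem _⟩, (hfin k').1, (hfin k').2.1, fun r hr => ?_⟩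
    obtain ⟨s, u, ψ, hψ, hval, hw⟩ := hvalue k' σ hσI hσχ r
      (fun q hq => hPr' (hr (Finset.mem_coe.2 hq))) (fun q hq => hKol' q (hr (Finset.mem_coe.2 hq)))
      (fun q hq => hC'.zpowers_eq_top (hr (Finset.mem_coe.2 hq)))
    obtain ⟨u', hu'⟩ := KatoValue.GeneralLevel.exists_unit_apply_localization_eq_of_derivativeFamily W 3
      P.f ι κK Λ c d a A z x (by decide) hbody (hfin k')
      (tateModuleRed W 3 (W.continuous_galoisRepTate_holds 3) (k' + 1))
      (AddSubgroup.inclusion (geomTorsion_pow_succ_eq W 3 k').le : _ →+ _) continuous_of_discreteTopology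
      (fun _ _ => rfl) (fun _ => rfl) D' hPr' σ Φ'' comm'' κu hΦ'' hKS' hres' hv₃p r hr s hval u hw
    exact ⟨u', ψ, hψ, hu'⟩

end Summit.BirchSwinnertonDyer.Rank1Residual.GaloisImage

end
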